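import Summits.KontsevichZagierPeriods.KontsevichZagierPeriods.Theorems.FermatIsogenyBetaLinearSectorSixthsNormalForms
import HarnessLib

/-!
# `BetaLinearSector` at level `6` — NORMAL FORM of the `π²/Γ(1/3)³`-class (the ten upper base cells), given the three links

Support file of crux `BetaLinearSector` (stmt-KontsevichZagierPeriods-3897, route FermatIsogeny), line `fermat-sector-transport`,
stub `normalForm_sixths_upper_of_links`.  After level reduction the level-`6` base cells are `β(a,b)`, `a, b ∈ {1/6, …, 1}`; the 26
LOWER cells (`a + b ≤ 1` or `a = 1` or `b = 1`) are normalised in `…SixthsNormalForms` (`normalForm_sixths_lower`).  The ten UPPER cells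
(`a + b > 1`, `a, b < 1`, i.e. `a, b ∈ {1/3, 1/2, 2/3, 5/6}` with `a + b > 1`; numerators in sixths `(2,5), (5,2), (3,4), (4,3), (3,5),
(5,3), (4,4), (4,5), (5,4), (5,5)`) form ONE class `ℚ̄·π²/Γ(1/3)³`.  This file normalises every one of them onto `q·T₃`,
`T₃ = [β(2/3,1/2)]` (cell `(4,3)`), `q` a positive real algebraic number, GIVEN as hypotheses the three links

* `L1`: `[β(2/3,1/2)-unit cell] ∼ [(1,∞), 2√3/(X²√(X³−1))]`,
* `L3`: `[β(2/3,5/6)-unit cell] ∼ [(1,∞), 4/(√3·X²√(X³−1))]`,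
* `L2`: `[β(1/3,5/6)-unit cell] ∼ [(3/2)2^{1/3}·β(2/3,5/6)]`

(proved by sibling stubs of the same wave).  Inside the calculus we realise here:

* the tail cell `G = [(1,∞), 1/(X²√(X³−1))]` (`upper_exists_tailRep`: dominated by the landed `[(1,∞), 1/√(X³−1)]`);
* ONE change of variables `x = X⁻³` (rule (2)) from `(1,∞)` onto `(0,1)`: `[β(5/6,1/2)-unit cell] ∼ 3·G`
  (`upper_fiveSixthsHalf_equivalent_tail`; pull-back `x^{-1/6}(1-x)^{-1/2}|dx/dX| = X^{1/2}·X^{3/2}(X³−1)^{-1/2}·3X⁻⁴ = 3/(X²√(X³−1))`);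
* the cells: `(4,3) = 1·T₃`, `(3,4)` swap, `(4,4) = 2^{-1/3}·T₃` (Legendre at `2/3`), `(5,3) = (√3/2)·T₃` (the move and `L1`), `(3,5)` swap,
  `(5,5) = 2^{-2/3}(√3/2)·T₃` (Legendre at `5/6`), `(4,5) = (2/3)·T₃` (`L3` and `L1`), `(5,4)` swap, `(2,5) = 2^{1/3}·T₃` (`L2`),
  `(5,2)` swap.

References: M. Kontsevich, D. Zagier, *Periods* (2001), §1.2; G. E. Andrews, R. Askey, R. Roy, *Special Functions* (1999), §1.5;
B. Gross, D. Rohrlich, *Some results on the Mordell–Weil group of the Jacobian of the Fermat curve*, Invent. Math. 44 (1978), §1.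
-/

noncomputable section

namespace Summit.KontsevichZagierPeriods.FermatIsogeny.BetaLinearSector.Sixths

open MeasureTheory Set Literature.NumberTheory.Transcendental Literature.NumberTheory.Transcendental.KZ HalfIntegers
open MvPolynomial (aeval X C)
open Summit.KontsevichZagierPeriods.FermatIsogeny.BetaLinearSector.Quarters (pinned_duplication)
open Summit.KontsevichZagierPeriods.HermiteRigidity.CMTwistQuasiPeriodTransfer
  (of_sub_of_mem_changeOfVariablesRel_dimOne image_fin_one)
open Summit.KontsevichZagierPeriods.KontsevichZagierPeriods.Theorems.GKZLevelThree
  (isSemialgebraicFunOn_ratFun₁ isAlgebraic_sqrt_three)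

set_option quotPrecheck false in
/-- `r` is PINNED as `[(0,1), c · t^{a-1}(1-t)^{b-1}]` (the two hypotheses on each representation in the crux, with a constant). -/
local notation "Pinned⟦" c ", " a ", " b ", " r "⟧" =>
  (IntegralRep.domain r = {x : Fin 1 → ℝ | x 0 ∈ Set.Ioo (0:ℝ) 1} ∧
    Set.EqOn (IntegralRep.integrand r) (fun x : Fin 1 → ℝ => (c : ℝ) * (x 0) ^ (((a : ℚ) : ℝ) - 1) * (1 - x 0) ^ (((b : ℚ) : ℝ) - 1))
      (IntegralRep.domain r))

set_option quotPrecheck false in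
/-- Link `L1`: the `(4,3)` unit cell onto the tail `[(1,∞), 2√3/(X²√(X³−1))]`. -/
local notation "Link₄₃" =>
  (∀ (U A : IntegralRep 1), U.domain = {x | x 0 ∈ Set.Ioo (0:ℝ) 1} →
    Set.EqOn U.integrand (fun x => (x 0) ^ (-(1:ℝ) / 3) * (1 - x 0) ^ (-(1:ℝ) / 2)) U.domain →
    A.domain = {x | 1 < x 0} →
    Set.EqOn A.integrand (fun x => 2 * Real.sqrt 3 / (x 0 ^ 2 * Real.sqrt (x 0 ^ 3 - 1))) A.domain → KZ.Equivalent U A)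

set_option quotPrecheck false in
/-- Link `L3`: the `(4,5)` unit cell onto the tail `[(1,∞), 4/(√3·X²√(X³−1))]`. -/
local notation "Link₄₅" =>
  (∀ (U A : IntegralRep 1), U.domain = {x | x 0 ∈ Set.Ioo (0:ℝ) 1} →
    Set.EqOn U.integrand (fun x => (x 0) ^ (-(1:ℝ) / 3) * (1 - x 0) ^ (-(1:ℝ) / 6)) U.domain →
    A.domain = {x | 1 < x 0} →
    Set.EqOn A.integrand (fun x => 4 / (Real.sqrt 3 * (x 0 ^ 2 * Real.sqrt (x 0 ^ 3 - 1)))) A.domain → KZ.Equivalent U A)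

set_option quotPrecheck false in
/-- Link `L2`: the `(2,5)` unit cell onto `(3/2)2^{1/3}` times the `(4,5)` unit cell. -/
local notation "Link₂₅" =>
  (∀ (U V : IntegralRep 1), U.domain = {x | x 0 ∈ Set.Ioo (0:ℝ) 1} →
    Set.EqOn U.integrand (fun x => (x 0) ^ (-(2:ℝ) / 3) * (1 - x 0) ^ (-(1:ℝ) / 6)) U.domain →
    V.domain = {x | x 0 ∈ Set.Ioo (0:ℝ) 1} →
    Set.EqOn V.integrand (fun x => (3 / 2 : ℝ) * (2:ℝ) ^ ((1:ℝ) / 3) * ((x 0) ^ (-(1:ℝ) / 3) * (1 - x 0) ^ (-(1:ℝ) / 6))) V.domain →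
    KZ.Equivalent U V)

/-! ## The tail cell `G = [(1,∞), 1/(X²√(X³−1))]` -/

/-- The tail cell `[(1,∞), 1/(X²√(X³−1))]` exists: domain and integrand `ℚ`-semialgebraic (`1/X²` is rational without pole on `X > 1`,
`1/√(X³−1)` is the integrand of the landed sector representation `exists_cubicMinusRep 1`), integrable by domination
`0 ≤ 1/(X²√(X³−1)) ≤ 1/√(X³−1)` on `X > 1`. [cite: KontsevichZagier2001, §1.1] -/
theorem upper_exists_tailRep : ∃ G : IntegralRep 1, G.domain = {x : Fin 1 → ℝ | 1 < x 0} ∧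
    G.integrand = fun x => 1 / (x 0 ^ 2 * Real.sqrt (x 0 ^ 3 - 1)) := by
  obtain ⟨T, hTd, hTi⟩ := exists_cubicMinusRep 1
  have hmem : ∀ x ∈ T.domain, 1 < x 0 := fun x hx => by rw [hTd] at hx; exact hx
  -- semialgebraic
  have h1 : IsSemialgebraicFunOn ℚ T.domain (fun x => (x 0 ^ 2)⁻¹) := by
    refine isSemialgebraicFunOn_ratFun₁ T.isSemialgebraic_domain 1 (X 0 ^ 2) (fun y => (y ^ 2)⁻¹)
      (fun x hx => ?_) (fun x _ => ?_)
    · simp only [map_pow, MvPolynomial.aeval_X]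
      exact pow_ne_zero 2 (one_pos.trans (hmem x hx)).ne'
    · simp
  have hsa : IsSemialgebraicFunOn ℚ {x : Fin 1 → ℝ | 1 < x 0} (fun x => 1 / (x 0 ^ 2 * Real.sqrt (x 0 ^ 3 - 1))) := by
    rw [← hTd]
    refine (IsSemialgebraicFunOn.mul_holds h1 T.isSemialgebraicFunOn_integrand).congr fun x _ => ?_
    simp only [Pi.mul_apply, hTi, Rat.cast_one, mul_inv, one_div]
  -- integrable, by domination
  have hint : IntegrableOn (fun x : Fin 1 → ℝ => 1 / (x 0 ^ 2 * Real.sqrt (x 0 ^ 3 - 1))) {x : Fin 1 → ℝ | 1 < x 0} := by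
    have hg : IntegrableOn (fun x : Fin 1 → ℝ => ((1:ℚ):ℝ) / Real.sqrt (x 0 ^ 3 - 1)) {x : Fin 1 → ℝ | 1 < x 0} := by
      rw [← hTd, ← hTi]
      exact T.integrableOn
    have hms : MeasurableSet {x : Fin 1 → ℝ | 1 < x 0} := measurableSet_lt measurable_const (measurable_pi_apply 0)
    refine Integrable.mono' hg ?_ ((ae_restrict_iff' hms).2 (ae_of_all _ fun x hx => ?_))
    · have hm : Measurable (fun x : Fin 1 → ℝ => 1 / (x 0 ^ 2 * Real.sqrt (x 0 ^ 3 - 1))) := by fun_prop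
      exact hm.aestronglyMeasurable
    · have hx1 : (1:ℝ) < x 0 := hx
      have hx0 : (0:ℝ) < x 0 := one_pos.trans hx1
      have hs : 0 < Real.sqrt (x 0 ^ 3 - 1) := Real.sqrt_pos.2 (sub_pos.2 (one_lt_pow₀ hx1 (by norm_num)))
      rw [Rat.cast_one, Real.norm_eq_abs, abs_of_nonneg (by positivity)]
      exact div_le_div_of_nonneg_left zero_le_one hs (le_mul_of_one_le_left hs.le (one_le_pow₀ hx1.le))
  exact ⟨⟨{x : Fin 1 → ℝ | 1 < x 0}, fun x => 1 / (x 0 ^ 2 * Real.sqrt (x 0 ^ 3 - 1)), hTd ▸ T.isSemialgebraic_domain, hsa, hint⟩,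
    rfl, rfl⟩

/-! ## The move `x = X⁻³`: `[β(5/6,1/2)-unit cell] ∼ [(1,∞), 3/(X²√(X³−1))]` -/

/-- The pull-back identity: for `X > 1`,
`((X³)⁻¹)^{-1/6} · (1 - (X³)⁻¹)^{-1/2} · |-(3X²)/(X³)²| = 3/(X²√(X³−1))`
(with `s = √X`, `t = √(X³−1)`: `s · (s³/t) · (3s⁴/s¹²) = 3/(s⁴t)`). [folklore] -/
theorem upper_sixthTail_pullback {x : ℝ} (hx : 1 < x) :
    ((x ^ 3)⁻¹) ^ (-(1:ℝ) / 6) * (1 - (x ^ 3)⁻¹) ^ (-(1:ℝ) / 2) *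
        |-(3 * x ^ 2) / (x ^ 3) ^ 2| = 3 / (x ^ 2 * Real.sqrt (x ^ 3 - 1)) := by
  have hx0 : 0 < x := one_pos.trans hx
  have hx3 : 0 < x ^ 3 - 1 := sub_pos.2 (one_lt_pow₀ hx (by norm_num))
  set s : ℝ := Real.sqrt x with hs
  set t : ℝ := Real.sqrt (x ^ 3 - 1) with ht
  have hs0 : 0 < s := Real.sqrt_pos.2 hx0
  have ht0 : 0 < t := Real.sqrt_pos.2 hx3
  have hsx : s ^ 2 = x := Real.sq_sqrt hx0.le
  have htx : t ^ 2 = x ^ 3 - 1 := Real.sq_sqrt hx3.le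
  have h6 : (6:ℕ) ≠ 0 := by norm_num
  have h2 : (2:ℕ) ≠ 0 := by norm_num
  have hx0' : x ≠ 0 := hx0.ne'
  have hs0' : s ≠ 0 := hs0.ne'
  have ht0' : t ≠ 0 := ht0.ne'
  -- `((X³)⁻¹)^{-1/6} = s`
  have hx6 : x ^ 3 = s ^ 6 := by rw [← hsx]; ring
  have hA : ((x ^ 3)⁻¹) ^ (-(1:ℝ) / 6) = s := by
    rw [hx6, show (-(1:ℝ) / 6) = -(((6:ℕ)⁻¹ : ℝ)) by norm_num, Real.rpow_neg (by positivity),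
      Real.inv_rpow (by positivity), inv_inv, Real.pow_rpow_inv_natCast hs0.le h6]
  -- `(1 - (X³)⁻¹)^{-1/2} = s³/t`
  have h1s : 1 - (x ^ 3)⁻¹ = t ^ 2 / (s ^ 3) ^ 2 := by
    have h36 : (s ^ 3) ^ 2 = x ^ 3 := by rw [← hsx]; ring
    have hx3' : x ^ 3 ≠ 0 := pow_ne_zero 3 hx0'
    rw [h36, htx]
    field_simp
  have hB : (1 - (x ^ 3)⁻¹) ^ (-(1:ℝ) / 2) = s ^ 3 / t := by
    rw [h1s, show (-(1:ℝ) / 2) = -((2:ℕ)⁻¹ : ℝ) by norm_num, Real.rpow_neg (by positivity),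
      Real.div_rpow (by positivity) (by positivity), Real.pow_rpow_inv_natCast ht0.le h2,
      Real.pow_rpow_inv_natCast (pow_nonneg hs0.le 3) h2, inv_div]
  -- `|φ'(X)| = 3X²/(X³)²`
  have hC : |-(3 * x ^ 2) / (x ^ 3) ^ 2| = 3 * x ^ 2 / (x ^ 3) ^ 2 := by
    rw [neg_div, abs_neg, abs_of_pos (by positivity)]
  rw [hA, hB, hC, ← hsx]
  field_simp

/-- **The move `x = X⁻³`.** `[(0,1), x^{-1/6}(1-x)^{-1/2}] ∼ [(1,∞), 3/(X²√(X³−1))]` (value `B(5/6,1/2)`): ONE change of variables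
`x = 1/X³` (rule (2)) carries `[(1,∞), 3/(X²√(X³−1))]` onto the Beta cell — `ℚ`-rational without pole on `X > 1`, injective with image
`(0,1)`, derivative `-3X²/(X³)²`, pull-back identity `upper_sixthTail_pullback` — and `KZ.Equivalent` is symmetric (template:
`stub_sixthBeta_equivalent_cubicTail`, exponent `-5/6` replaced by `-1/6`). [cite: KontsevichZagier2001, §1.2 rule (2)] -/
theorem upper_fiveSixthsHalf_equivalent_tail : ∀ (β T : KZ.IntegralRep 1), β.domain = {x | x 0 ∈ Set.Ioo (0:ℝ) 1} →
    Set.EqOn β.integrand (fun x => (x 0) ^ (-(1:ℝ) / 6) * (1 - x 0) ^ (-(1:ℝ) / 2)) β.domain → T.domain = {x | 1 < x 0} →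
    Set.EqOn T.integrand (fun x => 3 / (x 0 ^ 2 * Real.sqrt (x 0 ^ 3 - 1))) T.domain → KZ.Equivalent β T := by
  intro β T hβd hβi hTd hTi
  set φ : ℝ → ℝ := fun y => (y ^ 3)⁻¹ with hφ
  set φ' : ℝ → ℝ := fun y => -(3 * y ^ 2) / (y ^ 3) ^ 2 with hφ'
  have hmem : ∀ p ∈ T.domain, 1 < p 0 := fun p hp => by rw [hTd] at hp; exact hp
  refine KZ.Equivalent.symm (KZ.changeOfVariablesRel_subset_relations
    (of_sub_of_mem_changeOfVariablesRel_dimOne T β φ φ' ?_ ?_ ?_ ?_ ?_))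
  · -- semialgebraic: `1/X³`, a `ℚ`-rational function without pole on `X > 1`
    refine isSemialgebraicFunOn_ratFun₁ T.isSemialgebraic_domain 1 (X 0 ^ 3) φ
      (fun x hx => ?_) (fun x _ => ?_)
    · simp only [map_pow, MvPolynomial.aeval_X]
      exact pow_ne_zero 3 (one_pos.trans (hmem x hx)).ne'
    · simp [hφ]
  · -- derivative
    intro p hp
    exact sixthTail_hasDerivAt_subst (one_pos.trans (hmem p hp)).ne'
  · -- injective
    intro p hp q hq h
    exact sixthTail_subst_injective (zero_le_one.trans (hmem p hp).le)
      (zero_le_one.trans (hmem q hq).le) h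
  · -- image `φ '' (1,∞) = (0,1)`
    rw [hβd, hTd]
    exact (image_fin_one sixthTail_image_subst).symm
  · -- integrands
    intro p hp
    have hp' := hmem p hp
    have hφp : (fun _ : Fin 1 => φ (p 0)) ∈ β.domain := by
      rw [hβd]
      exact sixthTail_subst_mem hp'
    rw [hTi hp, hβi hφp]
    exact (upper_sixthTail_pullback hp').symm

/-! ## Generic plumbing through the tail -/

/-- Two cells equivalent to multiples `k·G`, `k₀·G` of one tail cell are proportional inside the calculus: from `U ∼ k·G`, `T ∼ k₀·G`
and `q k₀ = k` follows `U ∼ q·T` (scaling of the second equivalence by `q`, rule (1b) to merge the constants).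
[cite: KontsevichZagier2001, §1.2 rule (1)] -/
theorem upper_of_tail {U T G : IntegralRep 1} {k k₀ q : ℝ} (hk : IsAlgebraic ℚ k) (hk₀ : IsAlgebraic ℚ k₀) (hq : IsAlgebraic ℚ q)
    (hqk : q * k₀ = k) (eU : Equivalent U (G.constMul k hk)) (eT : Equivalent T (G.constMul k₀ hk₀)) :
    Equivalent U (T.constMul q hq) := by
  have c : Equivalent (G.constMul k hk) ((G.constMul k₀ hk₀).constMul q hq) :=
    of_sub_of_mem_relations_of_eqOn rfl fun x _ => by
      simp only [IntegralRep.integrand_constMul]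
      rw [← hqk]
      ring
  exact eU.trans (c.trans (eT.constMul q hq).symm)

/-! ## The unit cells of the `π²/Γ(1/3)³`-class, normalised onto `T₃ = [β(2/3,1/2)]` -/

section Upper

variable {T₃ : IntegralRep 1} (hT₃ : Pinned⟦(1:ℝ), (2/3:ℚ), (1/2:ℚ), T₃⟧)
include hT₃

/-- `(4,3)`: a unit cell `β(2/3,1/2)` IS `1·T₃`. -/
theorem upper_unit_43 {U : IntegralRep 1} (hU : Pinned⟦(1:ℝ), (2/3:ℚ), (1/2:ℚ), U⟧) : Equivalent U (T₃.constMul 1 isAlgebraic_one) :=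
  equivalent_constMul_of_pinned isAlgebraic_one hU hT₃ (by norm_num)

/-- `(4,4) ∼ 2^{-1/3}·(4,3)`: Legendre's duplication at `a = 2/3`. [cite: AndrewsAskeyRoy1999, Thm 1.5.1] -/
theorem upper_unit_44 {U : IntegralRep 1} (hU : Pinned⟦(1:ℝ), (2/3:ℚ), (2/3:ℚ), U⟧) :
    Equivalent U (T₃.constMul ((2:ℝ) ^ (((-1/3:ℚ)):ℝ)) (isAlgebraic_two_rpow (-1/3))) := by
  refine pinned_duplication (by norm_num) ?_ hU (pinned_constMul hT₃ _ _)
  norm_num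

/-- `L1` read on the canonical cell: `T₃ ∼ 2√3·G` for the tail cell `G = [(1,∞), 1/(X²√(X³−1))]`. -/
theorem upper_T₃_equivalent_tail (L1 : Link₄₃) {G : IntegralRep 1} (hGd : G.domain = {x : Fin 1 → ℝ | 1 < x 0})
    (hGi : G.integrand = fun x => 1 / (x 0 ^ 2 * Real.sqrt (x 0 ^ 3 - 1))) (hk : IsAlgebraic ℚ (2 * Real.sqrt 3)) :
    Equivalent T₃ (G.constMul (2 * Real.sqrt 3) hk) := by
  refine L1 T₃ _ hT₃.1 (fun x hx => ?_) (by rw [IntegralRep.domain_constMul, hGd]) (fun x _ => ?_)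
  · rw [hT₃.2 hx]
    norm_num
  · simp only [IntegralRep.integrand_constMul, hGi]
    ring

/-- `(5,3) ∼ (√3/2)·(4,3)`: the move `x = X⁻³` (`[β(5/6,1/2)] ∼ 3·G`) against `L1` (`T₃ ∼ 2√3·G`). -/
theorem upper_unit_53 (L1 : Link₄₃) {U : IntegralRep 1} (hU : Pinned⟦(1:ℝ), (5/6:ℚ), (1/2:ℚ), U⟧)
    (hq : IsAlgebraic ℚ (Real.sqrt 3 / 2)) : Equivalent U (T₃.constMul (Real.sqrt 3 / 2) hq) := by
  obtain ⟨G, hGd, hGi⟩ := upper_exists_tailRep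
  have h3 : IsAlgebraic ℚ (3:ℝ) := by simpa using isAlgebraic_nat (R := ℚ) (A := ℝ) 3
  have h2 : IsAlgebraic ℚ (2:ℝ) := by simpa using isAlgebraic_nat (R := ℚ) (A := ℝ) 2
  have h23 : IsAlgebraic ℚ (2 * Real.sqrt 3) := h2.mul isAlgebraic_sqrt_three
  have eU : Equivalent U (G.constMul 3 h3) := by
    refine upper_fiveSixthsHalf_equivalent_tail U _ hU.1 (fun x hx => ?_) (by rw [IntegralRep.domain_constMul, hGd]) (fun x _ => ?_)
    · rw [hU.2 hx]
      norm_num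
    · simp only [IntegralRep.integrand_constMul, hGi]
      ring
  refine upper_of_tail h3 h23 hq ?_ eU (upper_T₃_equivalent_tail hT₃ L1 hGd hGi h23)
  have h := Real.mul_self_sqrt (show (0:ℝ) ≤ 3 by norm_num)
  linear_combination h

/-- `(5,5) ∼ 2^{-2/3}(√3/2)·(4,3)`: Legendre's duplication at `a = 5/6` (`β(5/6,5/6) ∼ 2^{-2/3}β(5/6,1/2)`), then `(5,3)`.
[cite: AndrewsAskeyRoy1999, Thm 1.5.1] -/
theorem upper_unit_55 (L1 : Link₄₃) {U : IntegralRep 1} (hU : Pinned⟦(1:ℝ), (5/6:ℚ), (5/6:ℚ), U⟧)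
    (hq : IsAlgebraic ℚ (Real.sqrt 3 / 2)) (hk : IsAlgebraic ℚ ((2:ℝ) ^ (((-2/3:ℚ)):ℝ) * (Real.sqrt 3 / 2))) :
    Equivalent U (T₃.constMul ((2:ℝ) ^ (((-2/3:ℚ)):ℝ) * (Real.sqrt 3 / 2)) hk) := by
  obtain ⟨U₂, hU₂⟩ := exists_pinned 1 isAlgebraic_one (by norm_num : (0:ℚ) < 5/6) (by norm_num : (0:ℚ) < 1/2)
  have e₁ : Equivalent U (U₂.constMul ((2:ℝ) ^ (((-2/3:ℚ)):ℝ)) (isAlgebraic_two_rpow (-2/3))) := by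
    refine pinned_duplication (by norm_num) ?_ hU (pinned_constMul hU₂ _ _)
    norm_num
  have e₂ := (upper_unit_53 hT₃ L1 hU₂ hq).constMul ((2:ℝ) ^ (((-2/3:ℚ)):ℝ)) (isAlgebraic_two_rpow (-2/3))
  refine e₁.trans (e₂.trans (of_sub_of_mem_relations_of_eqOn rfl fun x _ => ?_))
  simp only [IntegralRep.integrand_constMul]
  ring

/-- `(4,5) ∼ (2/3)·(4,3)`: `L3` (`[β(2/3,5/6)] ∼ (4/√3)·G`) against `L1` (`T₃ ∼ 2√3·G`). -/
theorem upper_unit_45 (L1 : Link₄₃) (L3 : Link₄₅) {U : IntegralRep 1} (hU : Pinned⟦(1:ℝ), (2/3:ℚ), (5/6:ℚ), U⟧)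
    (hq : IsAlgebraic ℚ ((2:ℝ) / 3)) : Equivalent U (T₃.constMul ((2:ℝ) / 3) hq) := by
  obtain ⟨G, hGd, hGi⟩ := upper_exists_tailRep
  have hs : Real.sqrt 3 ≠ 0 := (Real.sqrt_pos.2 (by norm_num : (0:ℝ) < 3)).ne'
  have h4 : IsAlgebraic ℚ (4:ℝ) := by simpa using isAlgebraic_nat (R := ℚ) (A := ℝ) 4
  have h2 : IsAlgebraic ℚ (2:ℝ) := by simpa using isAlgebraic_nat (R := ℚ) (A := ℝ) 2
  have h23 : IsAlgebraic ℚ (2 * Real.sqrt 3) := h2.mul isAlgebraic_sqrt_three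
  have h43 : IsAlgebraic ℚ (4 / Real.sqrt 3) := by simpa [div_eq_mul_inv] using h4.mul isAlgebraic_sqrt_three.inv
  have eU : Equivalent U (G.constMul (4 / Real.sqrt 3) h43) := by
    refine L3 U _ hU.1 (fun x hx => ?_) (by rw [IntegralRep.domain_constMul, hGd]) (fun x _ => ?_)
    · rw [hU.2 hx]
      norm_num
    · simp only [IntegralRep.integrand_constMul, hGi]
      ring
  refine upper_of_tail h43 h23 hq ?_ eU (upper_T₃_equivalent_tail hT₃ L1 hGd hGi h23)
  have h := Real.mul_self_sqrt (show (0:ℝ) ≤ 3 by norm_num)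
  field_simp
  linear_combination 4 * h

/-- `(2,5) ∼ 2^{1/3}·(4,3)`: `L2` (`[β(1/3,5/6)] ∼ (3/2)2^{1/3}·[β(2/3,5/6)]`), then `(4,5)`. -/
theorem upper_unit_25 (L1 : Link₄₃) (L3 : Link₄₅) (L2 : Link₂₅) {U : IntegralRep 1} (hU : Pinned⟦(1:ℝ), (1/3:ℚ), (5/6:ℚ), U⟧)
    (hq : IsAlgebraic ℚ ((2:ℝ) / 3)) : Equivalent U (T₃.constMul ((2:ℝ) ^ (((1/3:ℚ)):ℝ)) (isAlgebraic_two_rpow (1/3))) := by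
  obtain ⟨U₂, hU₂⟩ := exists_pinned 1 isAlgebraic_one (by norm_num : (0:ℚ) < 2/3) (by norm_num : (0:ℚ) < 5/6)
  have hκ : IsAlgebraic ℚ ((3 / 2 : ℝ) * (2:ℝ) ^ ((1:ℝ) / 3)) := by
    have h32 : IsAlgebraic ℚ ((3 / 2 : ℝ)) := by simpa using isAlgebraic_algebraMap (R := ℚ) (A := ℝ) (3 / 2 : ℚ)
    have h13 := isAlgebraic_two_rpow (1/3)
    norm_num at h13
    exact h32.mul h13
  have e₁ : Equivalent U (U₂.constMul ((3 / 2 : ℝ) * (2:ℝ) ^ ((1:ℝ) / 3)) hκ) := by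
    refine L2 U _ hU.1 (fun x hx => ?_) (by rw [IntegralRep.domain_constMul, hU₂.1]) (fun x hx => ?_)
    · rw [hU.2 hx]
      norm_num
    · have hx' : x ∈ U₂.domain := by simpa using hx
      simp only [IntegralRep.integrand_constMul, hU₂.2 hx']
      norm_num
  have e₂ := (upper_unit_45 hT₃ L1 L3 hU₂ hq).constMul ((3 / 2 : ℝ) * (2:ℝ) ^ ((1:ℝ) / 3)) hκ
  refine e₁.trans (e₂.trans (of_sub_of_mem_relations_of_eqOn rfl fun x _ => ?_))
  simp only [IntegralRep.integrand_constMul, ← mul_assoc]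
  congr 1
  norm_num
  ring

end Upper

/-! ## The normal form of the ten upper base cells -/

/-- **NORMAL FORM OF THE UPPER LEVEL-6 BASE CELLS** (registered stub `normalForm_sixths_upper_of_links`): GIVEN the three links `L1`
(`[β(2/3,1/2)] ∼ [(1,∞), 2√3/(X²√(X³−1))]`), `L3` (`[β(2/3,5/6)] ∼ [(1,∞), 4/(√3X²√(X³−1))]`) and `L2`
(`[β(1/3,5/6)] ∼ [(3/2)2^{1/3}β(2/3,5/6)]`), every cell `[c·β(a,b)]`, `a, b ∈ {1/3, 1/2, 2/3, 5/6}`, `a + b > 1` — the class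
`ℚ̄·π²/Γ(1/3)³` — is a chain of moves away from `(c q)·T₃`, `q` positive real algebraic, `T₃ = [β(2/3,1/2)]`:
`q = 1, 1, 2^{-1/3}, √3/2, √3/2, 2^{-2/3}√3/2, 2/3, 2/3, 2^{1/3}, 2^{1/3}` on `(4,3), (3,4), (4,4), (5,3), (3,5), (5,5), (4,5), (5,4), (2,5), (5,2)`.
[cite: KontsevichZagier2001, §1.2] -/
theorem normalForm_sixths_upper_of_links : (∀ (U A : KZ.IntegralRep 1), U.domain = {x | x 0 ∈ Set.Ioo (0:ℝ) 1} → Set.EqOn U.integrand (fun x => (x 0) ^ (-(1:ℝ) / 3) * (1 - x 0) ^ (-(1:ℝ) / 2)) U.domain → A.domain = {x | 1 < x 0} → Set.EqOn A.integrand (fun x => 2 * Real.sqrt 3 / (x 0 ^ 2 * Real.sqrt (x 0 ^ 3 - 1))) A.domain → KZ.Equivalent U A) → (∀ (U A : KZ.IntegralRep 1), U.domain = {x | x 0 ∈ Set.Ioo (0:ℝ) 1} → Set.EqOn U.integrand (fun x => (x 0) ^ (-(1:ℝ) / 3) * (1 - x 0) ^ (-(1:ℝ) / 6)) U.domain → A.domain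 = {x | 1 < x 0} → Set.EqOn A.integrand (fun x => 4 / (Real.sqrt 3 * (x 0 ^ 2 * Real.sqrt (x 0 ^ 3 - 1)))) A.domain → KZ.Equivalent U A) → (∀ (U V : KZ.IntegralRep 1), U.domain = {x | x 0 ∈ Set.Ioo (0:ℝ) 1} → Set.EqOn U.integrand (fun x => (x 0) ^ (-(2:ℝ) / 3) * (1 - x 0) ^ (-(1:ℝ) / 6)) U.domain → V.domain = {x | x 0 ∈ Set.Ioo (0:ℝ) 1} → Set.EqOn V.integrand (fun x => (3 / 2 : ℝ) * (2:ℝ) ^ ((1:ℝ) / 3) * ((x 0) ^ (-(1:ℝ) / 3) * (1 - x 0) ^ (-(1:ℝ) / 6))) V.domain → KZ.Equivalent U V) → ∀ (c : ℝ), IsAlgebraic ℚ c → ∀ (a b : ℚ), (a = 1 / 3 ∨ a = 1 / 2 ∨ a = 2 / 3 ∨ a = 5 / 6) → (b = 1 / 3 ∨ b = 1 / 2 ∨ b = 2 / 3 ∨ b = 5 / 6) → 1 < a + b → ∀ (r T : KZ.IntegralRep 1), (r.domain = {x | x 0 ∈ Set.Ioo (0:ℝ) 1} ∧ Set.EqOn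 r.integrand (fun x => c * (x 0) ^ ((a:ℝ) - 1) * (1 - x 0) ^ ((b:ℝ) - 1)) r.domain) → (T.domain = {x | x 0 ∈ Set.Ioo (0:ℝ) 1} ∧ Set.EqOn T.integrand (fun x => (1:ℝ) * (x 0) ^ (((2/3:ℚ):ℝ) - 1) * (1 - x 0) ^ (((1/2:ℚ):ℝ) - 1)) T.domain) → ∃ (q : ℝ) (hk : IsAlgebraic ℚ (c * q)), 0 < q ∧ KZ.Equivalent r (T.constMul (c * q) hk) := by
  intro L1 L3 L2 c hc a b ha hb hab r T hr hT
  have hs : 0 < Real.sqrt 3 := Real.sqrt_pos.2 (by norm_num)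
  have h2 : IsAlgebraic ℚ (2:ℝ) := by simpa using isAlgebraic_nat (R := ℚ) (A := ℝ) 2
  have hq32 : IsAlgebraic ℚ (Real.sqrt 3 / 2) := by simpa [div_eq_mul_inv] using isAlgebraic_sqrt_three.mul h2.inv
  have hq23 : IsAlgebraic ℚ ((2:ℝ) / 3) := by simpa using isAlgebraic_algebraMap (R := ℚ) (A := ℝ) (2 / 3 : ℚ)
  have hr13 : (0:ℝ) < (2:ℝ) ^ (((1/3:ℚ)):ℝ) := Real.rpow_pos_of_pos (by norm_num) _
  have hrm13 : (0:ℝ) < (2:ℝ) ^ (((-1/3:ℚ)):ℝ) := Real.rpow_pos_of_pos (by norm_num) _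
  have hrm23 : (0:ℝ) < (2:ℝ) ^ (((-2/3:ℚ)):ℝ) := Real.rpow_pos_of_pos (by norm_num) _
  have hk55 : IsAlgebraic ℚ ((2:ℝ) ^ (((-2/3:ℚ)):ℝ) * (Real.sqrt 3 / 2)) := (isAlgebraic_two_rpow (-2/3)).mul hq32
  -- a unit cell for every pair of exponents
  have unit : ∀ {a b : ℚ}, 0 < a → 0 < b → ∃ U : IntegralRep 1, Pinned⟦(1:ℝ), a, b, U⟧ := fun ha hb => exists_pinned 1 isAlgebraic_one ha hb
  rcases hb with rfl | rfl | rfl | rfl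
  · -- b = 1/3: only `(5,2)` is upper
    rcases ha with rfl | rfl | rfl | rfl
    · exfalso; norm_num at hab
    · exfalso; norm_num at hab
    · exfalso; norm_num at hab
    · obtain ⟨U, hU⟩ := unit (by norm_num : (0:ℚ) < 1/3) (by norm_num : (0:ℚ) < 5/6)
      exact nf_via_unit_swap hc (isAlgebraic_two_rpow (1/3)) hr13 (by norm_num) (by norm_num) hr hU (upper_unit_25 hT L1 L3 L2 hU hq23)
  · -- b = 1/2: `(4,3)`, `(5,3)`
    rcases ha with rfl | rfl | rfl | rfl
    · exfalso; norm_num at hab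
    · exfalso; norm_num at hab
    · obtain ⟨U, hU⟩ := unit (by norm_num : (0:ℚ) < 2/3) (by norm_num : (0:ℚ) < 1/2)
      exact nf_via_unit hc isAlgebraic_one one_pos hr hU (upper_unit_43 hT hU)
    · obtain ⟨U, hU⟩ := unit (by norm_num : (0:ℚ) < 5/6) (by norm_num : (0:ℚ) < 1/2)
      exact nf_via_unit hc hq32 (by positivity) hr hU (upper_unit_53 hT L1 hU hq32)
  · -- b = 2/3: `(3,4)`, `(4,4)`, `(5,4)`
    rcases ha with rfl | rfl | rfl | rfl
    · exfalso; norm_num at hab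
    · obtain ⟨U, hU⟩ := unit (by norm_num : (0:ℚ) < 2/3) (by norm_num : (0:ℚ) < 1/2)
      exact nf_via_unit_swap hc isAlgebraic_one one_pos (by norm_num) (by norm_num) hr hU (upper_unit_43 hT hU)
    · obtain ⟨U, hU⟩ := unit (by norm_num : (0:ℚ) < 2/3) (by norm_num : (0:ℚ) < 2/3)
      exact nf_via_unit hc (isAlgebraic_two_rpow (-1/3)) hrm13 hr hU (upper_unit_44 hT hU)
    · obtain ⟨U, hU⟩ := unit (by norm_num : (0:ℚ) < 2/3) (by norm_num : (0:ℚ) < 5/6)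
      exact nf_via_unit_swap hc hq23 (by norm_num) (by norm_num) (by norm_num) hr hU (upper_unit_45 hT L1 L3 hU hq23)
  · -- b = 5/6: `(2,5)`, `(3,5)`, `(4,5)`, `(5,5)`
    rcases ha with rfl | rfl | rfl | rfl
    · obtain ⟨U, hU⟩ := unit (by norm_num : (0:ℚ) < 1/3) (by norm_num : (0:ℚ) < 5/6)
      exact nf_via_unit hc (isAlgebraic_two_rpow (1/3)) hr13 hr hU (upper_unit_25 hT L1 L3 L2 hU hq23)
    · obtain ⟨U, hU⟩ := unit (by norm_num : (0:ℚ) < 5/6) (by norm_num : (0:ℚ) < 1/2)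
      exact nf_via_unit_swap hc hq32 (by positivity) (by norm_num) (by norm_num) hr hU (upper_unit_53 hT L1 hU hq32)
    · obtain ⟨U, hU⟩ := unit (by norm_num : (0:ℚ) < 2/3) (by norm_num : (0:ℚ) < 5/6)
      exact nf_via_unit hc hq23 (by norm_num) hr hU (upper_unit_45 hT L1 L3 hU hq23)
    · obtain ⟨U, hU⟩ := unit (by norm_num : (0:ℚ) < 5/6) (by norm_num : (0:ℚ) < 5/6)
      exact nf_via_unit hc hk55 (mul_pos hrm23 (by positivity)) hr hU (upper_unit_55 hT L1 hU hq32 hk55)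

end Summit.KontsevichZagierPeriods.FermatIsogeny.BetaLinearSector.Sixths

end
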